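/-
Copyright (c) 2026. All rights reserved.
Released under Apache 2.0 license as described in the file LICENSE.
Authors: abc-iut cell, seat abc-iut-L4-t14 (gen 4; proof-only: `Isom(ℍ) = PGL₂(ℝ)` acting on `ℍ`
(Mathlib) compatibly with the tree's `PSL₂(ℝ)`-action, the anti-holomorphic involution `τ ↦ -τ̄`, and
SIGN-FREE FULLNESS of the uniformised model inside print's RC-category: every RC-holomorphic finite étale
map `ℍ/Λ̄₁ → ℍ/Λ̄₂` is `[τ] ↦ [q • τ]` for some `q ∈ PGL₂(ℝ)` conjugating `Λ̄₁` into `Λ̄₂`).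
-/
import Literature.AnabelianGeometry.AbsoluteAnabelian.ArchimedeanHolFieldFunctorGeometricPSL
import Literature.AnabelianGeometry.AbsoluteAnabelian.ArchimedeanHolFieldFunctorGeometricRC
import Mathlib.LinearAlgebra.Matrix.GeneralLinearGroup.Projective
import HarnessLib

/-!
# RC-morphisms between uniformised Riemann surfaces come from `PGL₂(ℝ) = Isom(ℍ)` (sign-free fullness)

S. Mochizuki, *Topics in absolute anabelian geometry III*, Def 4.1 (iii) p. 103 (the morphisms of `EA`
are "the finite étale morphisms" of Aut-holomorphic orbispaces, i.e. RC-HOLOMORPHIC maps, Cor 2.3 (i)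
p. 53) and proof of Prop 4.2 (i) p. 106 l. 14–19 ("the full subcategory of `EA` consisting of objects
that map to `X` may … be identified with … `Loc_R(X)`"); kurims `paper:url-5493eb38cbb7`, bib key
`MochizukiAbsTopIII2015`.  H. M. Farkas, I. Kra, *Riemann Surfaces*, IV.5.6 (`Aut ℍ = PSL(2, ℝ)`),
IV.7.1 (lifting to the universal covering).

abc-iut-L4-t14's `HolRS.exists_psl_of_hom` (p439430) identifies the HOLOMORPHIC morphisms
`ℍ/Λ̄₁ ⟶ ℍ/Λ̄₂` with the morphisms of `Loc(PSL₂(ℝ), Γ̄)`.  In print's RC-category (`HolRS.RC`,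
p425328) the morphisms may also be ANTI-holomorphic, and the ambient group of `Loc_R(X)` is the full
isometry group `Isom(ℍ) = PGL₂(ℝ)`, which Mathlib provides: `Matrix.ProjGenLinGroup (Fin 2) ℝ =
PGL(2, ℝ)` acting on `ℍ` (`UpperHalfPlane.glAction`, determinant `< 0` acting through complex
conjugation), the injection `Matrix.ProjectiveSpecialLinearGroup.toPGL : PSL(2, ℝ) →* PGL(2, ℝ)`
(abc-iut-L4-t14's `PSL2R` IS Mathlib's `PSL(2, ℝ)` definitionally), and the involution
`UpperHalfPlane.J`, `J • τ = -τ̄`.  PROOF-ONLY file (no definition, no named fact):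

* `HolRS.toGL_smul`, `HolRS.toPGL_smul` — the `PGL(2, ℝ)`-action extends the `PSL₂(ℝ)`-action;
* `HolRS.J_smul_J_smul`, `HolRS.continuous_J_smul`, **`HolRS.isAntiHolAt_J_smul`** — `τ ↦ J • τ = -τ̄`
  is a continuous ANTI-HOLOMORPHIC involution of `ℍ` (`ofComplex ∘ (z ↦ -z̄) ∘ coe`, L4-t8's calculus);
* `HolRS.exists_sl_lift_of_comp` — abc-iut-w5-d208's Möbius lifting (`UniformizedLift.exists_sl_lift`)
  with the holomorphy hypothesis on the COMPOSITE `h ∘ π₁` only (so that `π₁ = π ∘ (J • ·)` and `h`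
  may both be anti-holomorphic);
* ★ **`HolRS.RC.exists_pgl_of_hom`** — every RC-morphism `f : ℍ/Λ̄₁ ⟶ ℍ/Λ̄₂` (RC-holomorphic finite
  étale) is `[τ] ↦ [q • τ]` for some `q ∈ PGL(2, ℝ)` with `q Λ̄₁ q⁻¹ ≤ Λ̄₂` (inside `PGL(2, ℝ)`):
  holomorphic `f` by p439430; anti-holomorphic `f` by lifting the HOLOMORPHIC composite
  `f ∘ π₁ ∘ (J • ·)` to `γ ∈ SL(2, ℝ)` and taking `q = γ J` (determinant `-1`); the conjugation clause by
  abc-iut-w5-d208's `UniformizedLift.conj_mem_of_sl_lift` applied to the deck transformations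
  `J δ J` of `π₁ ∘ (J • ·)`.

So the RC-morphisms of the geometric `EA` between uniformised objects are EXACTLY the morphisms of the
group model `Loc(PGL₂(ℝ), Γ̄)` (abc-iut-L4-t14 p432943) — the RC analogue of the sign-free fullness of
p439430; with `HolRS.pgl_centralizer_eq_bot` (p448965) and abc-iut-L4-d1's slimness theorem this is the
input of the id-rigidity of print's `EA` (RC morphisms) over `X = ℍ/Γ̄`.  MODEL ≠ reconstruction;
nothing here bears on [IUTchIII] Cor. 3.12; typed ≠ proved.
-/

set_option autoImplicit false

noncomputable section

open scoped Manifold ContDiff Topology UpperHalfPlane MatrixGroups ComplexConjugate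
open _root_.MulAction _root_.CategoryTheory _root_.UpperHalfPlane

namespace Literature.AnabelianGeometry.AbsoluteAnabelian

namespace HolRS

/-! ### `PGL(2, ℝ)` on `ℍ` extends the `PSL₂(ℝ)`-action -/

/-- `(toGL γ) • τ = γ • τ` for `γ ∈ SL(2, ℝ)` (Mathlib's `GL(2, ℝ)`-action on `ℍ` extends the
`SL(2, ℝ)`-action). [cite: FarkasKra1992, IV.5.6] -/
theorem toGL_smul (γ : SL(2, ℝ)) (τ : ℍ) :
    (Matrix.SpecialLinearGroup.toGL γ : GL (Fin 2) ℝ) • τ = γ • τ := by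
  apply UpperHalfPlane.ext
  rw [UpperHalfPlane.coe_smul_of_det_pos (by simp), coe_sl_smul]
  simp [UpperHalfPlane.num, UpperHalfPlane.denom]

/-- `(toPGL p) • τ = p • τ` for `p ∈ PSL₂(ℝ)`: the tree's `PSL₂(ℝ)`-action (`HolRS.pslMulAction`) is
the restriction of Mathlib's `PGL(2, ℝ)`-action along `toPGL`. [cite: FarkasKra1992, IV.5.6] -/
theorem toPGL_smul (p : PSL2R) (τ : ℍ) :
    (Matrix.ProjectiveSpecialLinearGroup.toPGL (n := Fin 2) (R := ℝ) p) • τ = p • τ := by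
  induction p using QuotientGroup.induction_on with
  | H γ =>
    rw [Matrix.ProjectiveSpecialLinearGroup.toPGL_mk, UpperHalfPlane.pglMk_smul, toGL_smul,
      psl_mk_smul]

/-! ### The anti-holomorphic involution `τ ↦ J • τ = -τ̄` -/

/-- `J • (J • τ) = τ` (`J² = 1`). [cite: FarkasKra1992, IV.5.6] -/
theorem J_smul_J_smul (τ : ℍ) : UpperHalfPlane.J • UpperHalfPlane.J • τ = τ := by
  rw [← mul_smul, ← sq, UpperHalfPlane.J_sq, one_smul]

/-- `τ ↦ J • τ` is continuous (`= -τ̄` in the coordinate). [cite: FarkasKra1992, IV.5.6] -/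
theorem continuous_J_smul : Continuous fun τ : ℍ => UpperHalfPlane.J • τ := by
  refine UpperHalfPlane.isEmbedding_coe.continuous_iff.mpr ?_
  have : ((↑) : ℍ → ℂ) ∘ (fun τ : ℍ => UpperHalfPlane.J • τ) = fun τ : ℍ => -conj (τ : ℂ) := by
    funext τ; exact UpperHalfPlane.coe_J_smul τ
  rw [this]
  exact (Complex.continuous_conj.comp UpperHalfPlane.continuous_coe).neg

/-- `τ ↦ J • τ` as the composite `ofComplex ∘ (z ↦ -z̄) ∘ coe`. [cite: FarkasKra1992, IV.5.6] -/
theorem J_smul_eq_comp : (fun τ : ℍ => UpperHalfPlane.J • τ) =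
    UpperHalfPlane.ofComplex ∘ (fun z : ℂ => -conj z) ∘ ((↑) : ℍ → ℂ) := by
  funext τ
  apply UpperHalfPlane.ext
  have him : 0 < (-conj (τ : ℂ)).im := by simpa using τ.im_pos
  rw [UpperHalfPlane.coe_J_smul]
  simp only [Function.comp_apply]
  rw [UpperHalfPlane.ofComplex_apply_of_im_pos him]

/-- **`τ ↦ J • τ = -τ̄` is ANTI-HOLOMORPHIC at every point of `ℍ`** (holomorphic `ofComplex` ∘
anti-holomorphic `z ↦ -z̄` ∘ holomorphic `coe`, by abc-iut-L4-t8's composition rules).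
[cite: MochizukiAbsTopIII2015, Definition 2.1 (ii) p.51] -/
theorem isAntiHolAt_J_smul (τ : ℍ) : IsAntiHolAt (fun τ : ℍ => UpperHalfPlane.J • τ) τ := by
  rw [J_smul_eq_comp]
  -- `coe` holomorphic
  have hcoe : IsHolAt ((↑) : ℍ → ℂ) τ :=
    Filter.Eventually.of_forall fun σ => UpperHalfPlane.mdifferentiable_coe σ
  -- `z ↦ -z̄` anti-holomorphic on `ℂ`: `(-·) ∘ conj`
  have hneg : IsHolAt (fun z : ℂ => -z) (conj (τ : ℂ)) :=
    Filter.Eventually.of_forall fun z =>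
      mdifferentiableAt_iff_differentiableAt.mpr differentiable_neg.differentiableAt
  have hnc : IsAntiHolAt (fun z : ℂ => -conj z) (τ : ℂ) := by
    have : (fun z : ℂ => -conj z) = (fun z : ℂ => -z) ∘ fun z : ℂ => conj z := rfl
    rw [this]
    exact hneg.comp_isAntiHolAt (isAntiHolAt_conj _)
  have hA : IsAntiHolAt ((fun z : ℂ => -conj z) ∘ ((↑) : ℍ → ℂ)) τ := hnc.comp_isHolAt hcoe
  -- `ofComplex` holomorphic near `-τ̄` (open upper half plane)
  have hof : IsHolAt (UpperHalfPlane.ofComplex : ℂ → ℍ)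
      (((fun z : ℂ => -conj z) ∘ ((↑) : ℍ → ℂ)) τ) := by
    have him : 0 < (-conj (τ : ℂ)).im := by simpa using τ.im_pos
    have hopen : IsOpen {z : ℂ | 0 < z.im} := isOpen_lt continuous_const Complex.continuous_im
    change ∀ᶠ y in 𝓝 (-conj (τ : ℂ)), MDifferentiableAt 𝓘(ℂ, ℂ) 𝓘(ℂ, ℂ) UpperHalfPlane.ofComplex y
    filter_upwards [hopen.mem_nhds him] with z hz
    exact UpperHalfPlane.mdifferentiableAt_ofComplex hz
  exact IsHolAt.comp_isAntiHolAt (g := (UpperHalfPlane.ofComplex : ℂ → ℍ))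
    (f := (fun z : ℂ => -conj z) ∘ ((↑) : ℍ → ℂ)) hof hA

/-! ### Möbius lifting with holomorphy of the composite only -/

/-- **abc-iut-w5-d208's Möbius lifting with the holomorphy hypothesis on `h ∘ π₁` only**: for covering
maps `π₁ : ℍ → Y₁`, `π₂ : ℍ → Y₂`, `h : Y₁ → Y₂` with `h ∘ π₁` and `π₂` holomorphic and base points
`h (π₁ e₁) = π₂ e₂`, some `γ ∈ SL(2, ℝ)` lifts `h`: `π₂ (γ • τ) = h (π₁ τ)` (the topological lift
`UniformizedLift.exists_homeomorph_lift` is holomorphic over `π₂` by rigidity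
`diffeomorphOfHomeomorphOver`, hence Möbius by `exists_conjSmul_eq`).  Used with `π₁ = π ∘ (J • ·)`
and `h` anti-holomorphic. [cite: FarkasKra1992, IV.7.1 and IV.5.6] -/
theorem exists_sl_lift_of_comp {Y₁ Y₂ : Type} [TopologicalSpace Y₁] [TopologicalSpace Y₂]
    [ChartedSpace ℂ Y₂] [IsManifold 𝓘(ℂ, ℂ) ω Y₂] {π₁ : ℍ → Y₁} {π₂ : ℍ → Y₂} {h : Y₁ → Y₂}
    (hπ₁ : IsCoveringMap π₁) (hπ₂ : IsCoveringMap π₂) (hh : IsCoveringMap h)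
    (dcomp : MDifferentiable 𝓘(ℂ, ℂ) 𝓘(ℂ, ℂ) (h ∘ π₁)) (dπ₂ : MDifferentiable 𝓘(ℂ, ℂ) 𝓘(ℂ, ℂ) π₂)
    {e₁ e₂ : ℍ} (he : h (π₁ e₁) = π₂ e₂) :
    ∃ γ : SL(2, ℝ), ∀ τ : ℍ, π₂ (γ • τ) = h (π₁ τ) := by
  haveI : LocallyPathConnectedSpace ℍ := ChartedSpace.locallyPathConnectedSpace ℂ ℍ
  haveI : LocallyConnectedSpace Y₂ := ChartedSpace.locallyConnectedSpace ℂ Y₂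
  obtain ⟨g, hg, -⟩ := UniformizedLift.exists_homeomorph_lift hπ₁ hπ₂ hh he
  have hp : IsLocalDiffeomorph 𝓘(ℂ, ℂ) 𝓘(ℂ, ℂ) ω (h ∘ π₁) :=
    isLocalDiffeomorph_of_mdifferentiable_of_isLocalHomeomorph dcomp
      (hh.isLocalHomeomorph.comp hπ₁.isLocalHomeomorph)
  have hq : IsLocalDiffeomorph 𝓘(ℂ, ℂ) 𝓘(ℂ, ℂ) ω π₂ :=
    isLocalDiffeomorph_of_mdifferentiable_of_isLocalHomeomorph dπ₂ hπ₂.isLocalHomeomorph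
  let G := Literature.Geometry.Kaehler.diffeomorphOfHomeomorphOver g hp hq (funext hg)
  have hψ : MDifferentiable 𝓘(ℂ, ℂ) 𝓘(ℂ, ℂ) g := G.contMDiff.mdifferentiable (by simp)
  have hψs : MDifferentiable 𝓘(ℂ, ℂ) 𝓘(ℂ, ℂ) g.symm := G.symm.contMDiff.mdifferentiable (by simp)
  obtain ⟨γ, hγ⟩ := exists_conjSmul_eq (Y := ℍ) (Homeomorph.refl ℍ) mdifferentiable_id
    mdifferentiable_id hψ hψs
  refine ⟨γ, fun τ => ?_⟩
  have hγ' : γ • τ = g τ := by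
    have := congrArg (fun φ : ℍ ≃ₜ ℍ => φ τ) hγ
    simpa using this
  rw [hγ']
  exact hg τ

/-! ### Sign-free fullness in the RC-category -/

/-- `J δ J ∈ SL(2, ℝ)` for `δ ∈ SL(2, ℝ)` (the outer automorphism of `SL(2, ℝ)`; entries
`(a, -b; -c, d)`), as an element of `GL(2, ℝ)`: `J * toGL δ * J = toGL δ'` with `δ' ∈ SL(2, ℝ)`.
[cite: FarkasKra1992, IV.5.6] -/
theorem exists_toGL_eq_J_mul_toGL_mul_J (δ : SL(2, ℝ)) : ∃ δ' : SL(2, ℝ),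
    (Matrix.SpecialLinearGroup.toGL δ' : GL (Fin 2) ℝ) =
      UpperHalfPlane.J * Matrix.SpecialLinearGroup.toGL δ * UpperHalfPlane.J := by
  have hdet : ((UpperHalfPlane.J * Matrix.SpecialLinearGroup.toGL δ * UpperHalfPlane.J : GL (Fin 2) ℝ) :
      Matrix (Fin 2) (Fin 2) ℝ).det = 1 := by
    rw [Matrix.GeneralLinearGroup.coe_mul, Matrix.GeneralLinearGroup.coe_mul, Matrix.det_mul,
      Matrix.det_mul, Matrix.SpecialLinearGroup.coe_GL_coe_matrix, Matrix.SpecialLinearGroup.det_coe]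
    have : (UpperHalfPlane.J : Matrix (Fin 2) (Fin 2) ℝ).det = -1 := by
      rw [← Matrix.GeneralLinearGroup.val_det_apply, UpperHalfPlane.det_J]; simp
    rw [this]; norm_num
  refine ⟨⟨_, hdet⟩, ?_⟩
  apply Units.ext
  rfl

/-- ★ **Sign-free fullness of the uniformised model in print's RC-category**: for `Λ̄₁, Λ̄₂ ≤ PSL₂(ℝ)`
acting freely and properly discontinuously on `ℍ`, every RC-HOLOMORPHIC finite étale map
`f : ℍ/Λ̄₁ → ℍ/Λ̄₂` (a morphism of `HolRS.RC`) is `[τ] ↦ [q • τ]` for some `q ∈ PGL(2, ℝ) = Isom(ℍ)`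
with `q Λ̄₁ q⁻¹ ≤ Λ̄₂` (conjugation inside `PGL(2, ℝ)`, `Λ̄ᵢ` embedded by `toPGL`).  Holomorphic `f`:
p439430's `exists_psl_of_hom`; anti-holomorphic `f`: the composite `f ∘ π₁ ∘ (J • ·)` is HOLOMORPHIC
(anti ∘ anti) and lifts to `γ ∈ SL(2, ℝ)` (`exists_sl_lift_of_comp`); then `q = γ J`
(determinant `-1`: an orientation-reversing isometry), and `q Λ̄₁ q⁻¹ ≤ Λ̄₂` by abc-iut-w5-d208's
`UniformizedLift.conj_mem_of_sl_lift` for the deck transformations `J δ J` of `π₁ ∘ (J • ·)`.  Hence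
the RC-morphisms between objects over `X = ℍ/Γ̄` are EXACTLY those of `Loc(PGL₂(ℝ), Γ̄)`.
[cite: MochizukiAbsTopIII2015, Proposition 4.2 (i) proof p.106] -/
theorem RC.exists_pgl_of_hom (Λ₁ Λ₂ : Subgroup PSL2R) [ProperlyDiscontinuousSMul Λ₁ ℍ]
    [IsCancelSMul Λ₁ ℍ] [ProperlyDiscontinuousSMul Λ₂ ℍ] [IsCancelSMul Λ₂ ℍ]
    (f : RCHom (pslQuotient Λ₁) (pslQuotient Λ₂)) :
    ∃ q : PGL(2, ℝ), (∀ τ : ℍ, f.toFun (Quotient.mk _ τ) = Quotient.mk _ (q • τ)) ∧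
      ∀ x ∈ Λ₁, q * Matrix.ProjectiveSpecialLinearGroup.toPGL x * q⁻¹ ∈
        Λ₂.map (Matrix.ProjectiveSpecialLinearGroup.toPGL (n := Fin 2) (R := ℝ)) := by
  rcases f.isHol_or_isAntiHol with hhol | hanti
  · -- holomorphic: a `HolRS`-morphism, p439430
    let f' : pslQuotient Λ₁ ⟶ pslQuotient Λ₂ :=
      { toFun := f.toFun
        mdifferentiable := fun p => (hhol p).mdifferentiableAt
        isFiniteEtale := f.isFiniteEtale }
    obtain ⟨p, hp, hpΛ⟩ := exists_psl_of_hom Λ₁ Λ₂ f'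
    refine ⟨Matrix.ProjectiveSpecialLinearGroup.toPGL p, fun τ => ?_, fun x hx => ?_⟩
    · rw [toPGL_smul]; exact hp τ
    · rw [← map_mul, ← map_inv, ← map_mul]
      exact Subgroup.mem_map_of_mem _ (hpΛ x hx)
  · -- anti-holomorphic: lift the holomorphic composite `f ∘ π₁ ∘ (J • ·)`
    let π₁ : ℍ → (pslQuotient Λ₁).carrier := Quotient.mk (orbitRel Λ₁ ℍ)
    let π₂ : ℍ → (pslQuotient Λ₂).carrier := Quotient.mk (orbitRel Λ₂ ℍ)
    have hπ₁ : IsCoveringMap π₁ :=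
      (isQuotientCoveringMap_quotientMk_of_properlyDiscontinuousSMul (G := Λ₁) (E := ℍ)).isCoveringMap
    have hπ₂ : IsCoveringMap π₂ :=
      (isQuotientCoveringMap_quotientMk_of_properlyDiscontinuousSMul (G := Λ₂) (E := ℍ)).isCoveringMap
    have dπ₁ : MDifferentiable 𝓘(ℂ, ℂ) 𝓘(ℂ, ℂ) π₁ :=
      (Literature.Geometry.Manifold.QuotientManifold.contMDiff_mk (G := Λ₁) (n := ω)
        (fun k => contMDiff_psl_smul (k : PSL2R))).mdifferentiable (by simp)
    have dπ₂ : MDifferentiable 𝓘(ℂ, ℂ) 𝓘(ℂ, ℂ) π₂ :=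
      (Literature.Geometry.Manifold.QuotientManifold.contMDiff_mk (G := Λ₂) (n := ω)
        (fun k => contMDiff_psl_smul (k : PSL2R))).mdifferentiable (by simp)
    -- the homeomorphism `τ ↦ J • τ` and the covering map `π₁' = π₁ ∘ (J • ·)`
    let ι : ℍ ≃ₜ ℍ :=
      { toFun := fun τ => UpperHalfPlane.J • τ
        invFun := fun τ => UpperHalfPlane.J • τ
        left_inv := J_smul_J_smul
        right_inv := J_smul_J_smul
        continuous_toFun := continuous_J_smul
        continuous_invFun := continuous_J_smul }
    have hπ₁' : IsCoveringMap (π₁ ∘ ι) := hπ₁.comp_homeomorph ι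
    -- `f ∘ (π₁ ∘ ι)` is holomorphic: anti ∘ (hol ∘ anti)
    have dcomp : MDifferentiable 𝓘(ℂ, ℂ) 𝓘(ℂ, ℂ) (f.toFun ∘ (π₁ ∘ ι)) := by
      intro τ
      have h1 : IsAntiHolAt (π₁ ∘ ι) τ :=
        IsHolAt.comp_isAntiHolAt (Filter.Eventually.of_forall fun σ => dπ₁ σ) (isAntiHolAt_J_smul τ)
      exact ((hanti _).comp_isAntiHolAt h1).mdifferentiableAt
    obtain ⟨e₂, he₂⟩ := Quotient.exists_rep (f.toFun ((π₁ ∘ ι) UpperHalfPlane.I))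
    obtain ⟨γ, hγ⟩ := exists_sl_lift_of_comp hπ₁' hπ₂ f.isFiniteEtale.isCoveringMap dcomp dπ₂
      (e₁ := UpperHalfPlane.I) (e₂ := e₂) he₂.symm
    -- `q := γ J`
    refine ⟨Matrix.ProjGenLinGroup.mk (Matrix.SpecialLinearGroup.toGL γ * UpperHalfPlane.J),
      fun τ => ?_, fun x hx => ?_⟩
    · have key := hγ (UpperHalfPlane.J • τ)
      have hι : ι (UpperHalfPlane.J • τ) = τ := J_smul_J_smul τ
      simp only [Function.comp_apply] at key
      rw [hι] at key
      rw [UpperHalfPlane.pglMk_smul, mul_smul, toGL_smul]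
      exact key.symm
    · -- the preimage of `Λ̄₂` in `SL(2, ℝ)` acts as the covering group of `π₂`
      let Λ₂' : Subgroup SL(2, ℝ) := Λ₂.comap (QuotientGroup.mk' (Subgroup.center SL(2, ℝ)))
      have hneg : (-1 : SL(2, ℝ)) ∈ Λ₂' := by
        change (QuotientGroup.mk (-1) : PSL2R) ∈ Λ₂
        have : (QuotientGroup.mk (-1) : PSL2R) = 1 :=
          (QuotientGroup.eq_one_iff _).mpr (mem_center_sl_iff.mpr (Or.inr rfl))
        rw [this]
        exact Λ₂.one_mem
      have hdeck : ∀ μ ∈ Λ₂', ∀ τ : ℍ, π₂ (μ • τ) = π₂ τ := fun μ hμ τ =>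
        Quotient.sound ⟨⟨QuotientGroup.mk μ, hμ⟩, rfl⟩
      have horb : ∀ τ τ' : ℍ, π₂ τ = π₂ τ' → ∃ μ ∈ Λ₂', μ • τ = τ' := by
        intro τ τ' h
        obtain ⟨m, hm⟩ := Quotient.exact h
        obtain ⟨μ, hμ⟩ := QuotientGroup.mk_surjective ((m⁻¹ : Λ₂) : PSL2R)
        refine ⟨μ, ?_, ?_⟩
        · change (QuotientGroup.mk μ : PSL2R) ∈ Λ₂
          rw [hμ]
          exact (m⁻¹).2
        · rw [← psl_mk_smul, hμ, ← hm]
          exact inv_smul_smul m τ'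
      -- a lift `δ` of `x`, and the deck transformation `δ' = J δ J` of `π₁ ∘ ι`
      obtain ⟨δ, hδ⟩ := QuotientGroup.mk_surjective x
      obtain ⟨δ', hδ'⟩ := exists_toGL_eq_J_mul_toGL_mul_J δ
      have hδ'deck : ∀ τ : ℍ, (π₁ ∘ ι) (δ' • τ) = (π₁ ∘ ι) τ := by
        intro τ
        simp only [Function.comp_apply]
        change π₁ (UpperHalfPlane.J • δ' • τ) = π₁ (UpperHalfPlane.J • τ)
        have e1 : UpperHalfPlane.J • δ' • τ = δ • UpperHalfPlane.J • τ := by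
          rw [← toGL_smul δ', ← toGL_smul δ, ← mul_smul, ← mul_smul, hδ', ← mul_assoc, ← mul_assoc,
            ← sq, UpperHalfPlane.J_sq, one_mul]
        rw [e1, ← psl_mk_smul, hδ]
        exact Quotient.sound ⟨⟨x, hx⟩, rfl⟩
      have hconj := UniformizedLift.conj_mem_of_sl_lift hπ₂ Λ₂' hneg hdeck horb hγ hδ'deck
      -- read the conclusion in `PGL(2, ℝ)`
      change (QuotientGroup.mk (γ * δ' * γ⁻¹) : PSL2R) ∈ Λ₂ at hconj
      have hJinv : (UpperHalfPlane.J : GL (Fin 2) ℝ)⁻¹ = UpperHalfPlane.J :=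
        inv_eq_of_mul_eq_one_right (by rw [← sq, UpperHalfPlane.J_sq])
      have heq : Matrix.ProjGenLinGroup.mk (Matrix.SpecialLinearGroup.toGL γ * UpperHalfPlane.J) *
            Matrix.ProjectiveSpecialLinearGroup.toPGL x *
            (Matrix.ProjGenLinGroup.mk (Matrix.SpecialLinearGroup.toGL γ * UpperHalfPlane.J))⁻¹ =
          Matrix.ProjectiveSpecialLinearGroup.toPGL (QuotientGroup.mk (γ * δ' * γ⁻¹) : PSL2R) := by
        rw [← hδ, Matrix.ProjectiveSpecialLinearGroup.toPGL_mk, Matrix.ProjectiveSpecialLinearGroup.toPGL_mk,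
          ← map_inv, ← map_mul, ← map_mul]
        congr 1
        rw [map_mul, map_mul, map_inv, hδ', mul_inv_rev, hJinv]
        simp only [mul_assoc]
      rw [heq]
      exact Subgroup.mem_map_of_mem _ hconj

/-- The same for a morphism of the RC-CATEGORY between the objects `⟨ℍ/Λ̄₁⟩`, `⟨ℍ/Λ̄₂⟩`.
[cite: MochizukiAbsTopIII2015, Proposition 4.2 (i) proof p.106] -/
theorem RC.exists_pgl_of_hom' (Λ₁ Λ₂ : Subgroup PSL2R) [ProperlyDiscontinuousSMul Λ₁ ℍ]
    [IsCancelSMul Λ₁ ℍ] [ProperlyDiscontinuousSMul Λ₂ ℍ] [IsCancelSMul Λ₂ ℍ]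
    (f : (⟨pslQuotient Λ₁⟩ : RC) ⟶ ⟨pslQuotient Λ₂⟩) :
    ∃ q : PGL(2, ℝ), (∀ τ : ℍ, f.toFun (Quotient.mk _ τ) = Quotient.mk _ (q • τ)) ∧
      ∀ x ∈ Λ₁, q * Matrix.ProjectiveSpecialLinearGroup.toPGL x * q⁻¹ ∈
        Λ₂.map (Matrix.ProjectiveSpecialLinearGroup.toPGL (n := Fin 2) (R := ℝ)) :=
  RC.exists_pgl_of_hom Λ₁ Λ₂ f

end HolRS

end Literature.AnabelianGeometry.AbsoluteAnabelian

end
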